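import Mathlib
import HarnessLib
import HarnessLib.Audit
import Summits.CriticalPhenomena.PercolationContinuityZ3.Theorems.PercNearOneGluingNoHeavyLowerTailHexMSDelta

/-!
# Conjecture (MATCH): dead members inject into their absent far products — and (MATCH) ⟹ Δ-HEX (hp-7 gen 67)

Support file for crux `stmt-CriticalPhenomena-4575` (route `PercNearOneGluingNoHeavy`), hull-port seat `prim-hp-7` (generation 67);
`--supports stmt-CriticalPhenomena-4575`.  No `sorry`.  Memo: `run/shared/lean/prim/prim-hp-7/FROM-prim-hp-7-g67-EXTREME-DIRECTIONS.md` §0 (M1), §6.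

For an antipodal instance `(U, 𝒟, x)` (vocabulary of `…HexMSDelta`): a member `s ∈ 𝒟` is DEAD if `s ∉ symGen U 𝒟 x` (it is neither a far meet nor a far
join); its CANDIDATES are the absent far products of `s` itself, `farProducts 𝒟 x s \ 𝒟` where
`farProducts 𝒟 x s = {s ∩ d, s ∪ d : d ∈ 𝒟, ¬ Close (x s) (x d)}`.

* `MatchHall U 𝒟 x` — **Conjecture (MATCH)** (gen 67): Hall's condition for the bipartite graph dead members ↔ candidates, i.e. for every set
  `A` of dead members, `#A ≤ #(⋃_{s ∈ A} candidates s)`.  Exhaustively verified for all 5 764 800 instances on `2^[4]`, exactly (SAT) on `2^[5]`,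
  and on every hard instance of the programme's corpora (memo §6); its Marica–Schönheim analogue is a theorem (`…HexMSDeadMatching`).  An
  obligation (`def … : Prop`), never asserted.
* `farProducts_subset_symGen` — candidates are far products, hence lie in `symGen`.
* `deltaHexRel_of_matchHall` — **(MATCH) ⟹ Δ-HEX**: `#𝒟 = #dead + #(alive) ≤ #(symGen \ 𝒟) + #(symGen ∩ 𝒟) = #symGen`.
So Conjecture (MATCH) is a Hall-type (matching) strengthening of Δ-HEX that needs no induction on the dimension — unlike Δ-R_n (g65), which gen 67
found to hold with at most ONE non-deficient direction at n = 6, 7, 8.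
-/

namespace Summit.CriticalPhenomena.PercolationContinuityZ3.Theorems

namespace GeneratedDonors

open Finset

variable {α : Type*} [DecidableEq α]

section Match

variable (U : Finset α) (𝒟 : Finset (Finset α)) (x : Finset α → ZMod 6)

/-- The far products of a member `s`: meets and joins of `s` with the members of `𝒟` whose label is far from that of `s`. -/
def farProducts (s : Finset α) : Finset (Finset α) :=
  ((𝒟.filter fun d => ¬ Close (x s) (x d)).image fun d => s ∩ d) ∪
    ((𝒟.filter fun d => ¬ Close (x s) (x d)).image fun d => s ∪ d)

/-- The dead members: members of `𝒟` that are not far meets/joins. -/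
def dead : Finset (Finset α) := 𝒟.filter fun s => s ∉ symGen U 𝒟 x

/-- The candidates of `s`: its absent far products. -/
def candidates (s : Finset α) : Finset (Finset α) := farProducts 𝒟 x s \ 𝒟

/-- **Conjecture (MATCH)** (hp-7 g67): Hall's condition — every set `A` of dead members has at least `#A` candidates in total.  Equivalently (Hall's
marriage theorem) the dead members can be matched injectively to absent far products of themselves.  An obligation, not a fact. -/
def MatchHall : Prop :=
  ∀ A ⊆ dead U 𝒟 x, #A ≤ #(A.biUnion (candidates 𝒟 x))

variable {U 𝒟 x}

/-- Membership in `farProducts`. -/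
theorem mem_farProducts {s p : Finset α} :
    p ∈ farProducts 𝒟 x s ↔ ∃ d ∈ 𝒟, ¬ Close (x s) (x d) ∧ (p = s ∩ d ∨ p = s ∪ d) := by
  unfold farProducts
  simp only [mem_union, mem_image, mem_filter]
  constructor
  · rintro (⟨d, ⟨hd, hf⟩, rfl⟩ | ⟨d, ⟨hd, hf⟩, rfl⟩)
    · exact ⟨d, hd, hf, Or.inl rfl⟩
    · exact ⟨d, hd, hf, Or.inr rfl⟩
  · rintro ⟨d, hd, hf, rfl | rfl⟩
    · exact Or.inl ⟨d, ⟨hd, hf⟩, rfl⟩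
    · exact Or.inr ⟨d, ⟨hd, hf⟩, rfl⟩

/-- Of two labels that are not close, the antipode of the first is close to the second. -/
theorem close_add_three_left_of_not_close {s t : ZMod 6} (h : ¬ Close s t) : Close (s + 3) t := by
  revert s t; decide

/-- **Candidates are far products, hence in `symGen`.** (`s ∩ d = s \ (U \ d)` is a generated difference and `s ∪ d = U \ ((U \ s) \ d)` the
complement of one.) -/
theorem farProducts_subset_symGen (hU : ∀ a ∈ 𝒟, a ⊆ U) (hco : ∀ a ∈ 𝒟, U \ a ∈ 𝒟)
    (hanti : ∀ a ∈ 𝒟, x (U \ a) = x a + 3) {s : Finset α} (hs : s ∈ 𝒟) :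
    farProducts 𝒟 x s ⊆ symGen U 𝒟 x := by
  intro p hp
  obtain ⟨d, hd, hfar, rfl | rfl⟩ := mem_farProducts.mp hp
  · -- s ∩ d = s \ (U \ d), and x (U \ d) = x d + 3 is close to x s
    have h1 : s \ (U \ d) = s ∩ d := sdiff_univ_compl_eq_inter (hU s hs)
    have hcl : Close (x s) (x (U \ d)) := by
      rw [hanti d hd]
      have key : ∀ a b : ZMod 6, ¬ Close a b → Close a (b + 3) := by decide
      exact key _ _ hfar
    unfold symGen
    exact mem_union_left _ (mem_gen.mpr ⟨s, hs, U \ d, hco d hd, hcl, h1⟩)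
  · -- s ∪ d = U \ ((U \ s) \ d) with (U \ s) \ d a generated difference
    have hgen : (U \ s) \ d ∈ gen 𝒟 x :=
      mem_gen.mpr ⟨U \ s, hco s hs, d, hd, by rw [hanti s hs]; exact close_add_three_left_of_not_close hfar, rfl⟩
    have h2 : U \ ((U \ s) \ d) = s ∪ d := by
      ext i
      simp only [mem_sdiff, mem_union, not_and, not_not]
      constructor
      · intro ⟨hiU, h⟩
        by_cases his : i ∈ s
        · exact Or.inl his
        · exact Or.inr (h ⟨hiU, his⟩)
      · rintro (his | hid)
        · exact ⟨hU s hs his, fun h => absurd his h.2⟩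
        · exact ⟨hU d hd hid, fun _ => hid⟩
    unfold symGen
    exact mem_union_right _ (mem_image.mpr ⟨(U \ s) \ d, hgen, h2⟩)

/-- **(MATCH) ⟹ Δ-HEX.**  Hall's condition for the full dead set gives `#dead ≤ #(symGen \ 𝒟)`; the alive members lie in `symGen` by definition. -/
theorem deltaHexRel_of_matchHall (hM : MatchHall U 𝒟 x) : DeltaHexRel U 𝒟 x := by
  intro hU hco hanti
  classical
  have hdead : #(dead U 𝒟 x) ≤ #(symGen U 𝒟 x \ 𝒟) := by
    refine (hM (dead U 𝒟 x) subset_rfl).trans (card_le_card ?_)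
    intro p hp
    obtain ⟨s, hs, hps⟩ := mem_biUnion.mp hp
    unfold candidates at hps
    rw [mem_sdiff] at hps ⊢
    have hsD : s ∈ 𝒟 := (mem_filter.mp (show s ∈ dead U 𝒟 x from hs)).1
    exact ⟨farProducts_subset_symGen hU hco hanti hsD hps.1, hps.2⟩
  have halive : 𝒟.filter (fun s => s ∈ symGen U 𝒟 x) ⊆ symGen U 𝒟 x ∩ 𝒟 := by
    intro s hs
    rw [mem_filter] at hs
    exact mem_inter.mpr ⟨hs.2, hs.1⟩
  have hsplit : #(𝒟.filter fun s => s ∈ symGen U 𝒟 x) + #(dead U 𝒟 x) = #𝒟 :=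
    card_filter_add_card_filter_not (s := 𝒟) (fun s => s ∈ symGen U 𝒟 x)
  have hS : #(symGen U 𝒟 x \ 𝒟) + #(symGen U 𝒟 x ∩ 𝒟) = #(symGen U 𝒟 x) :=
    card_sdiff_add_card_inter (symGen U 𝒟 x) 𝒟
  have := card_le_card halive
  omega

end Match

end GeneratedDonors

end Summit.CriticalPhenomena.PercolationContinuityZ3.Theorems
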